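import Literature.Probability.LatticeModels.IndependencePolynomial
import HarnessLib

/-!
# Proof of the Peters–Regts theorem (Sokal's conjecture) on the roots of the independence polynomial

Topic `Literature/Probability/LatticeModels` — companion ("Proofs") file of
`IndependencePolynomial.lean`, discharging its named fact `PetersRegts2019_zeroFree`
[PetersRegts2019, Thm. 1.1]: for every `Δ ≥ 3` there is a complex domain `D_Δ ⊇ [0, λ_c(Δ))`,
`λ_c(Δ) = (Δ-1)^{Δ-1}/(Δ-2)^Δ`, such that `Z_G(z) ≠ 0` for every `z ∈ D_Δ` and every finite graph
`G` of maximum degree at most `Δ` (`PetersRegts2019_zeroFree_holds`).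

The architecture is that of [PetersRegts2019, §§2–4]: a forward-invariant region for the ratios
under the Weitz recursion `R_{K,v} = z / ∏ᵢ (1 + R_{Kᵢ,uᵢ})` (ibid. Lemma 2.2), an induction
over vertex subsets carrying the region along (ibid. proof of Thm. 4.2; here
`polymerPartitionFunction_adj_ne_zero_of_region`, a sibling of the Dobrushin–Shearer induction
`polymerPartitionFunction_adj_ne_zero` of the main file), and the union over centres of the
resulting zero-free balls (ibid. proof of Thm. 1.1).  The invariant region is built in the
coordinate `s = log (1 + R)`, in which the recursion reads `s ↦ log (1 + z e^{-∑ sᵢ})` and only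
the *sum* of the children enters (this is the role played by the convexity of `exp D` in ibid.
Lemma 4.1), with the width profile `|Im s| ≤ ε √(1 - e^{-Re s}) = ε √(R/(1+R))` of the
Li–Lu–Yin / Restrepo–Shin–Tetali–Vigoda–Yang potential `2 arsinh √R` instead of the double
logarithm `φ_y = log (1 + y log (1 + R))` of ibid. §3.  With this choice the contraction up to
`λ_c` (ibid. Prop. 3.6) becomes the elementary tangent-line inequality
`PetersRegts.tangent_ineq` (Bernoulli) plus Cauchy–Schwarz and Jensen for `exp`
(`PetersRegts.sum_sqrt_one_sub_exp_le`), the complex step of ibid. Lemma 4.1 is a first-order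
perturbation estimate (`PetersRegts.norm_one_add_mul_exp_neg_sub_le`, `PetersRegts.log_estimates`,
`PetersRegts.numeric_core`), and no numerics are needed (`PetersRegts.region_step`).  Near
`z = 0`, where this region degenerates, Shearer's disc
(`independencePolynomial_ne_zero_of_norm_lt`) takes over.

Not here: the multivariate `ε`-version (ibid. Thm. 4.2 as printed, with `λ_v` varying), the
optimality of `λ_c(Δ)` (ibid. Prop. 1.2), explicit radii.

## References

* H. Peters, G. Regts, *On a conjecture of Sokal concerning roots of the independence
  polynomial*, Michigan Math. J. **68** (2019) 33–55, arXiv:1701.08049 (numbering of the arXiv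
  version): §2 (2.1)–(2.3), Lemma 2.2, Thm. 2.3, Prop. 3.6, Lemma 4.1, Thm. 4.2, proof of
  Thm. 1.1. [PetersRegts2019]
* A. D. Scott, A. D. Sokal, *The repulsive lattice gas, the independent-set polynomial, and the
  Lovász local lemma*, J. Stat. Phys. **118** (2005) 1151–1261: Cor. 5.7 (Shearer's disc).
  [ScottSokal2005]
-/

open Finset

namespace Literature.Probability.LatticeModels

namespace PetersRegts

/-- **Tangent-line inequality** behind the contraction of the hard-core tree recursion up to
the uniqueness threshold: for `K : ℕ` and real `q ≥ 0`,
`(K+1)^{K+3} (q - 1) ≤ K^{K+2} q^{K+2} + (K+1)^{K+1} q`, i.e. with `k = K + 1` and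
`λₖ = k^k/(k-1)^{k+1}`: `λₖ k² (q - 1) ≤ q^{k+1} + λₖ q` — the convex function `q ↦ q^{k+1}`
lies above its tangent at `q = k/(k-1)` (equality there); Bernoulli's inequality.
[folklore] -/
theorem tangent_ineq (K : ℕ) {q : ℝ} (hq : 0 ≤ q) :
    ((K : ℝ) + 1) ^ (K + 3) * (q - 1) ≤
      (K : ℝ) ^ (K + 2) * q ^ (K + 2) + ((K : ℝ) + 1) ^ (K + 1) * q := by
  have hK : (0 : ℝ) < K + 1 := by positivity
  have hK0 : (0 : ℝ) ≤ K := K.cast_nonneg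
  set a : ℝ := ((K : ℝ) * q - (K + 1)) / (K + 1) with ha
  have ha2 : -2 ≤ a := by
    rw [ha, le_div_iff₀ hK]
    nlinarith
  have hB := one_add_mul_le_pow ha2 (K + 2)
  have h1a : 1 + a = K * q / (K + 1) := by
    rw [ha]
    field_simp
    ring
  rw [h1a, div_pow, mul_pow, le_div_iff₀ (by positivity)] at hB
  push_cast at hB
  rw [ha] at hB
  have key : ((K : ℝ) + 1) ^ (K + 1) * ((K + 1) + (K + 2) * (K * q - (K + 1))) ≤
      (K : ℝ) ^ (K + 2) * q ^ (K + 2) := by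
    have : (1 + ((K : ℝ) + 2) * ((K * q - (K + 1)) / (K + 1))) * ((K : ℝ) + 1) ^ (K + 2) =
        ((K : ℝ) + 1) ^ (K + 1) * ((K + 1) + (K + 2) * (K * q - (K + 1))) := by
      field_simp
      ring
    rw [← this]
    exact hB
  linear_combination key

/-- `λ_c(K + 2) = (K+1)^{K+1} / K^{K+2}` (the threshold with the natural subtractions
resolved). [cite: PetersRegts2019, §1] -/
theorem hardCoreThreshold_add_two (K : ℕ) :
    hardCoreThreshold (K + 2) = ((K : ℝ) + 1) ^ (K + 1) / (K : ℝ) ^ (K + 2) := by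
  rw [hardCoreThreshold, show K + 2 - 1 = K + 1 from rfl]
  push_cast
  ring_nf

/-- One step of the monotonicity of the threshold in the degree: `λ_c(K+3) ≤ λ_c(K+2)` for
`K ≥ 1`, i.e. `(K² + 2K)^{K+2} ≤ (K² + 2K + 1)^{K+2}`. [folklore] -/
theorem hardCoreThreshold_add_three_le (K : ℕ) (hK : 1 ≤ K) :
    hardCoreThreshold (K + 3) ≤ hardCoreThreshold (K + 2) := by
  rw [show K + 3 = (K + 1) + 2 from rfl, hardCoreThreshold_add_two, hardCoreThreshold_add_two]
  have hK' : (1 : ℝ) ≤ K := by exact_mod_cast hK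
  push_cast
  rw [div_le_div_iff₀ (by positivity) (by positivity)]
  calc ((K : ℝ) + 1 + 1) ^ (K + 1 + 1) * (K : ℝ) ^ (K + 2)
      = (((K : ℝ) + 2) * K) ^ (K + 2) := by rw [mul_pow]; ring
    _ ≤ (((K : ℝ) + 1) ^ 2) ^ (K + 2) := pow_le_pow_left₀ (by positivity) (by nlinarith) _
    _ = ((K : ℝ) + 1) ^ (2 * (K + 2)) := by rw [← pow_mul]
    _ = ((K : ℝ) + 1) ^ (K + 1) * ((K : ℝ) + 1) ^ (K + 1 + 2) := by rw [← pow_add]; ring_nf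

/-- The threshold `λ_c(Δ) = (Δ-1)^{Δ-1}/(Δ-2)^Δ` is non-increasing in `Δ ≥ 3`:
`λ_c(K + 2 + j) ≤ λ_c(K + 2)` for `K ≥ 1`. [folklore] -/
theorem hardCoreThreshold_anti {K j : ℕ} (hK : 1 ≤ K) :
    hardCoreThreshold (K + 2 + j) ≤ hardCoreThreshold (K + 2) := by
  induction j with
  | zero => exact le_rfl
  | succ j ih =>
    calc hardCoreThreshold (K + 2 + (j + 1)) = hardCoreThreshold ((K + j) + 3) := by ring_nf
      _ ≤ hardCoreThreshold ((K + j) + 2) := hardCoreThreshold_add_three_le _ (by omega)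
      _ = hardCoreThreshold (K + 2 + j) := by ring_nf
      _ ≤ _ := ih

/-- `λ_c(Δ) ≤ λ_c(3) = 4` for every `Δ ≥ 3`. [folklore] -/
theorem hardCoreThreshold_le_four {Δ : ℕ} (hΔ : 3 ≤ Δ) : hardCoreThreshold Δ ≤ 4 := by
  obtain ⟨j, rfl⟩ : ∃ j, Δ = 1 + 2 + j := ⟨Δ - 3, by omega⟩
  calc hardCoreThreshold (1 + 2 + j) ≤ hardCoreThreshold (1 + 2) := hardCoreThreshold_anti le_rfl
    _ = 4 := by rw [hardCoreThreshold_three]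

/-- `λ_c(Δ) ≤ λ_c(k + 1)` for `2 ≤ k` and `k + 1 ≤ Δ` (a vertex with `k ≤ Δ - 1` children
contracts at least as well as one with `Δ - 1` children). [folklore] -/
theorem hardCoreThreshold_mono_down {k Δ : ℕ} (hk : 2 ≤ k) (hkΔ : k + 1 ≤ Δ) :
    hardCoreThreshold Δ ≤ hardCoreThreshold (k + 1) := by
  obtain ⟨j, rfl⟩ : ∃ j, Δ = (k - 1) + 2 + j := ⟨Δ - (k + 1), by omega⟩
  calc hardCoreThreshold ((k - 1) + 2 + j) ≤ hardCoreThreshold ((k - 1) + 2) :=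
        hardCoreThreshold_anti (by omega)
    _ = hardCoreThreshold (k + 1) := by congr 1; omega

/-- **Real contraction of the `k`-ary hard-core recursion up to the tree threshold**
(the content of [PetersRegts2019, Prop. 3.6], in Li–Lu–Yin potential form): for `1 ≤ k`,
`0 < t < Λ ≤ λ_c(k+1)` (or `k = 1`) and `q ≥ 1`,
`k² (q - 1) t ≤ κ² (q^{k+1} + t q)` with `κ² = t (Λ+1) / (Λ (1+t)) < 1`.  Writing
`q = 1 + x̄` and `f = t q^{-k}` this is `k² · x̄/(1+x̄) · f/(1+f) ≤ κ²`, the squared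
`ℓ¹`-gradient bound of the recursion in the potential `2 arsinh √R` at the symmetric point.
From `tangent_ineq` and `λ_c(k+1) ≥ Λ`. [cite: PetersRegts2019, Prop. 3.6] -/
theorem contraction_ineq_q {k : ℕ} (hk : 1 ≤ k) {Λ t q : ℝ} (hΛ : 0 < Λ) (ht0 : 0 < t)
    (htΛ : t < Λ) (hq : 1 ≤ q) (hkΛ : k = 1 ∨ Λ ≤ hardCoreThreshold (k + 1)) :
    (k : ℝ) ^ 2 * (q - 1) * t ≤ t * (Λ + 1) / (Λ * (1 + t)) * (q ^ (k + 1) + t * q) := by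
  have hq0 : 0 ≤ q := zero_le_one.trans hq
  have hqk : q ≤ q ^ (k + 1) := le_self_pow₀ hq (by omega)
  -- Step 1: `k² (q - 1) ≤ q^(k+1) / Λ + q`
  have step1 : (k : ℝ) ^ 2 * (q - 1) ≤ q ^ (k + 1) / Λ + q := by
    rcases hkΛ with rfl | hkΛ
    · have : (0 : ℝ) ≤ q ^ (1 + 1) / Λ := by positivity
      push_cast
      nlinarith
    · obtain ⟨K, rfl⟩ : ∃ K, k = K + 1 := ⟨k - 1, by omega⟩
      rcases Nat.eq_zero_or_pos K with rfl | hKpos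
      · have : (0 : ℝ) ≤ q ^ (0 + 1 + 1) / Λ := by positivity
        push_cast
        nlinarith
      have hL : hardCoreThreshold (K + 1 + 1) = ((K : ℝ) + 1) ^ (K + 1) / (K : ℝ) ^ (K + 2) :=
        hardCoreThreshold_add_two K
      rw [hL] at hkΛ
      have hKr : (0 : ℝ) < K := by exact_mod_cast hKpos
      have hKp : (0 : ℝ) < (K : ℝ) ^ (K + 2) := by positivity
      have hK1p : (0 : ℝ) < ((K : ℝ) + 1) ^ (K + 1) := by positivity
      -- the tangent inequality divided by `(K+1)^(K+1)`; `K^(K+2)/(K+1)^(K+1) = 1/λₖ ≤ 1/Λ`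
      have h1 : ((K : ℝ) + 1) ^ 2 * (q - 1) ≤
          (K : ℝ) ^ (K + 2) / ((K : ℝ) + 1) ^ (K + 1) * q ^ (K + 2) + q := by
        rw [div_mul_eq_mul_div, div_add' _ _ _ hK1p.ne', le_div_iff₀ hK1p]
        calc ((K : ℝ) + 1) ^ 2 * (q - 1) * ((K : ℝ) + 1) ^ (K + 1)
            = ((K : ℝ) + 1) ^ (K + 3) * (q - 1) := by ring
          _ ≤ _ := tangent_ineq K hq0
          _ = _ := by ring
      have h2 : (K : ℝ) ^ (K + 2) / ((K : ℝ) + 1) ^ (K + 1) ≤ 1 / Λ := by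
        rw [div_le_div_iff₀ hK1p hΛ, one_mul]
        calc (K : ℝ) ^ (K + 2) * Λ
            ≤ (K : ℝ) ^ (K + 2) * (((K : ℝ) + 1) ^ (K + 1) / (K : ℝ) ^ (K + 2)) :=
              mul_le_mul_of_nonneg_left hkΛ hKp.le
          _ = ((K : ℝ) + 1) ^ (K + 1) := by field_simp
      push_cast
      calc ((K : ℝ) + 1) ^ 2 * (q - 1)
          ≤ (K : ℝ) ^ (K + 2) / ((K : ℝ) + 1) ^ (K + 1) * q ^ (K + 2) + q := h1
        _ ≤ 1 / Λ * q ^ (K + 2) + q := by gcongr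
        _ = q ^ (K + 1 + 1) / Λ + q := by ring
  -- Step 2: multiply by `t` and compare with `κ² (q^(k+1) + t q)`
  have hcoef : 0 ≤ t * (Λ - t) / (Λ * (1 + t)) :=
    div_nonneg (mul_nonneg ht0.le (by linarith)) (by positivity)
  have key : t * (q ^ (k + 1) / Λ + q) ≤ t * (Λ + 1) / (Λ * (1 + t)) * (q ^ (k + 1) + t * q) := by
    have : t * (Λ + 1) / (Λ * (1 + t)) * (q ^ (k + 1) + t * q) - t * (q ^ (k + 1) / Λ + q) =
        t * (Λ - t) / (Λ * (1 + t)) * (q ^ (k + 1) - q) := by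
      field_simp
      ring
    nlinarith [mul_nonneg hcoef (sub_nonneg.2 hqk)]
  calc (k : ℝ) ^ 2 * (q - 1) * t = t * ((k : ℝ) ^ 2 * (q - 1)) := by ring
    _ ≤ t * (q ^ (k + 1) / Λ + q) := mul_le_mul_of_nonneg_left step1 ht0.le
    _ ≤ _ := key

/-- The contraction inequality in exponential form: for `1 ≤ k`, `0 < t < Λ ≤ λ_c(k+1)`
(or `k = 1`) and `A ≥ 0`, `k² (1 - e^{-A/k}) · t e^{-A} ≤ κ² (1 + t e^{-A})`
(`contraction_ineq_q` at `q = e^{A/k}`). [cite: PetersRegts2019, Prop. 3.6] -/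
theorem contraction_ineq_exp {k : ℕ} (hk : 1 ≤ k) {Λ t A : ℝ} (hΛ : 0 < Λ) (ht0 : 0 < t)
    (htΛ : t < Λ) (hA : 0 ≤ A) (hkΛ : k = 1 ∨ Λ ≤ hardCoreThreshold (k + 1)) :
    (k : ℝ) ^ 2 * (1 - Real.exp (-(A / k))) * (t * Real.exp (-A)) ≤
      t * (Λ + 1) / (Λ * (1 + t)) * (1 + t * Real.exp (-A)) := by
  set q : ℝ := Real.exp (A / k) with hq
  have hk0 : (k : ℝ) ≠ 0 := by exact_mod_cast (show k ≠ 0 by omega)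
  have hq1 : 1 ≤ q := Real.one_le_exp (div_nonneg hA k.cast_nonneg)
  have hq0 : 0 < q := Real.exp_pos _
  have hqA : Real.exp A = q ^ k := by
    rw [hq, ← Real.exp_nat_mul]; congr 1; field_simp
  have h1 : Real.exp (-(A / k)) = q⁻¹ := by rw [Real.exp_neg]
  have h2 : Real.exp (-A) = (q ^ k)⁻¹ := by rw [Real.exp_neg, hqA]
  rw [h1, h2]
  have hmain := contraction_ineq_q hk hΛ ht0 htΛ hq1 hkΛ
  have hqk : (0 : ℝ) < q ^ (k + 1) := by positivity
  rw [show (k : ℝ) ^ 2 * (1 - q⁻¹) * (t * (q ^ k)⁻¹) = (k : ℝ) ^ 2 * (q - 1) * t / q ^ (k + 1) by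
    field_simp; ring,
    show t * (Λ + 1) / (Λ * (1 + t)) * (1 + t * (q ^ k)⁻¹) =
      t * (Λ + 1) / (Λ * (1 + t)) * (q ^ (k + 1) + t * q) / q ^ (k + 1) by
    field_simp; ring]
  exact div_le_div_of_nonneg_right hmain hqk.le

/-- **Symmetrisation** (the step replacing the convexity of `exp D` in
[PetersRegts2019, Lemma 4.1]): for a nonempty finite family `σᵢ ≥ 0` with sum `A` and `k`
members, `∑ᵢ √(1 - e^{-σᵢ}) ≤ k √(1 - e^{-A/k})` — Cauchy–Schwarz followed by Jensen's
inequality for `exp` (`k e^{-A/k} ≤ ∑ᵢ e^{-σᵢ}`). [folklore] -/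
theorem sum_sqrt_one_sub_exp_le {ι : Type*} {M : Finset ι} (hM : M.Nonempty) (σ : ι → ℝ)
    (hσ : ∀ i ∈ M, 0 ≤ σ i) :
    ∑ i ∈ M, √(1 - Real.exp (-σ i)) ≤
      M.card * √(1 - Real.exp (-((∑ i ∈ M, σ i) / M.card))) := by
  set k : ℕ := M.card with hk
  have hkpos : 0 < k := card_pos.2 hM
  have hkr : (0 : ℝ) < k := by exact_mod_cast hkpos
  -- Jensen for `exp`: `k · exp (-A/k) ≤ ∑ exp (-σ i)`
  have hJ : (k : ℝ) * Real.exp (-((∑ i ∈ M, σ i) / k)) ≤ ∑ i ∈ M, Real.exp (-σ i) := by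
    have h := (convexOn_exp).map_sum_le (t := M) (w := fun _ => (k : ℝ)⁻¹) (p := fun i => -σ i)
      (fun _ _ => by positivity)
      (by rw [sum_const, nsmul_eq_mul, ← hk, mul_inv_cancel₀ hkr.ne'])
      (fun _ _ => Set.mem_univ _)
    simp only [smul_eq_mul, ← mul_sum] at h
    have e : (k : ℝ)⁻¹ * ∑ i ∈ M, -σ i = -((∑ i ∈ M, σ i) / k) := by
      rw [sum_neg_distrib]; ring
    rw [e] at h
    calc (k : ℝ) * Real.exp (-((∑ i ∈ M, σ i) / k))
        ≤ (k : ℝ) * ((k : ℝ)⁻¹ * ∑ i ∈ M, Real.exp (-σ i)) :=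
          mul_le_mul_of_nonneg_left h hkr.le
      _ = _ := by field_simp
  -- nonnegativity of the summands
  have hy : ∀ i ∈ M, 0 ≤ 1 - Real.exp (-σ i) := fun i hi => by
    rw [sub_nonneg, Real.exp_le_one_iff, neg_nonpos]; exact hσ i hi
  have hA : 0 ≤ 1 - Real.exp (-((∑ i ∈ M, σ i) / k)) := by
    rw [sub_nonneg, Real.exp_le_one_iff, neg_nonpos]
    exact div_nonneg (sum_nonneg hσ) hkr.le
  -- Cauchy–Schwarz
  have hCS : (∑ i ∈ M, √(1 - Real.exp (-σ i))) ^ 2 ≤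
      ((k : ℝ) * √(1 - Real.exp (-((∑ i ∈ M, σ i) / k)))) ^ 2 := by
    calc (∑ i ∈ M, √(1 - Real.exp (-σ i))) ^ 2
        = (∑ i ∈ M, √(1 - Real.exp (-σ i)) * 1) ^ 2 := by simp
      _ ≤ (∑ i ∈ M, √(1 - Real.exp (-σ i)) ^ 2) * ∑ i ∈ M, (1 : ℝ) ^ 2 :=
          sum_mul_sq_le_sq_mul_sq _ _ _
      _ = (∑ i ∈ M, (1 - Real.exp (-σ i))) * k := by
          rw [sum_congr rfl fun i hi => Real.sq_sqrt (hy i hi)]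
          simp [hk]
      _ = ((k : ℝ) - ∑ i ∈ M, Real.exp (-σ i)) * k := by
          rw [sum_sub_distrib, sum_const, nsmul_eq_mul, mul_one]
      _ ≤ ((k : ℝ) - k * Real.exp (-((∑ i ∈ M, σ i) / k))) * k := by gcongr
      _ = ((k : ℝ) * √(1 - Real.exp (-((∑ i ∈ M, σ i) / k)))) ^ 2 := by
          rw [mul_pow, Real.sq_sqrt hA]; ring
  exact (pow_le_pow_iff_left₀ (sum_nonneg fun i _ => Real.sqrt_nonneg _) (by positivity)
    two_ne_zero).1 hCS

/-- **The contraction bound for a family of children** ([PetersRegts2019, Prop. 3.6 and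
Lemma 4.1] combined, real part): if `0 < t < Λ = λ_c(d+1)`, `#M ≤ d` and `σᵢ ≥ 0`, then with
`β = ∑ᵢ √(1 - e^{-σᵢ})` and `m = t e^{-∑ σᵢ}`: `β² m ≤ κ² (1 + m)`,
`κ² = t(Λ+1)/(Λ(1+t))`. [cite: PetersRegts2019, Lemma 4.1] -/
theorem contraction_bound {d : ℕ} {Λ t : ℝ} (hΛ : Λ = hardCoreThreshold (d + 1))
    (hΛpos : 0 < Λ) (ht0 : 0 < t) (htΛ : t < Λ) {ι : Type*} {M : Finset ι}
    (hMd : M.card ≤ d) (σ : ι → ℝ) (hσ : ∀ i ∈ M, 0 ≤ σ i) :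
    (∑ i ∈ M, √(1 - Real.exp (-σ i))) ^ 2 * (t * Real.exp (-∑ i ∈ M, σ i)) ≤
      t * (Λ + 1) / (Λ * (1 + t)) * (1 + t * Real.exp (-∑ i ∈ M, σ i)) := by
  rcases M.eq_empty_or_nonempty with hM | hM
  · rw [hM, sum_empty, sum_empty]
    simp only [ne_eq, OfNat.ofNat_ne_zero, not_false_eq_true, zero_pow, zero_mul]
    positivity
  set k : ℕ := M.card with hk
  set A : ℝ := ∑ i ∈ M, σ i with hA
  have hk1 : 1 ≤ k := card_pos.2 hM
  have hA0 : 0 ≤ A := sum_nonneg hσ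
  have hF2 := sum_sqrt_one_sub_exp_le hM σ hσ
  rw [← hA, ← hk] at hF2
  have hx0 : 0 ≤ 1 - Real.exp (-(A / k)) := by
    rw [sub_nonneg, Real.exp_le_one_iff, neg_nonpos]; positivity
  have hβ0 : 0 ≤ ∑ i ∈ M, √(1 - Real.exp (-σ i)) := sum_nonneg fun i _ => Real.sqrt_nonneg _
  have hβ2 : (∑ i ∈ M, √(1 - Real.exp (-σ i))) ^ 2 ≤
      (k : ℝ) ^ 2 * (1 - Real.exp (-(A / k))) := by
    calc (∑ i ∈ M, √(1 - Real.exp (-σ i))) ^ 2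
        ≤ ((k : ℝ) * √(1 - Real.exp (-(A / k)))) ^ 2 := pow_le_pow_left₀ hβ0 hF2 2
      _ = _ := by rw [mul_pow, Real.sq_sqrt hx0]
  have hkΛ : k = 1 ∨ Λ ≤ hardCoreThreshold (k + 1) := by
    rcases Nat.lt_or_ge k 2 with h2 | h2
    · left; omega
    · right; rw [hΛ]; exact hardCoreThreshold_mono_down h2 (by omega)
  have hC := contraction_ineq_exp hk1 hΛpos ht0 htΛ hA0 hkΛ
  calc (∑ i ∈ M, √(1 - Real.exp (-σ i))) ^ 2 * (t * Real.exp (-A))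
      ≤ (k : ℝ) ^ 2 * (1 - Real.exp (-(A / k))) * (t * Real.exp (-A)) :=
        mul_le_mul_of_nonneg_right hβ2 (by positivity)
    _ ≤ _ := hC

/-- For `Re u > 0`, `|arg u| ≤ |Im u| / Re u` (`|θ| ≤ |tan θ|` on `(-π/2, π/2)`). [folklore] -/
theorem abs_arg_le_abs_im_div_re {u : ℂ} (hu : 0 < u.re) :
    |Complex.arg u| ≤ |u.im| / u.re := by
  have h := Complex.abs_arg_lt_pi_div_two_iff.2 (Or.inl hu)
  have key : |Complex.arg u| ≤ |Real.tan (Complex.arg u)| := by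
    rcases le_or_gt 0 (Complex.arg u) with h0 | h0
    · rw [abs_of_nonneg h0]
      exact (Real.le_tan h0 (abs_lt.1 h).2).trans (le_abs_self _)
    · rw [abs_of_neg h0]
      have h1 : -Complex.arg u < Real.pi / 2 := by linarith [(abs_lt.1 h).1]
      calc -Complex.arg u ≤ Real.tan (-Complex.arg u) := Real.le_tan (by linarith) h1
        _ = -Real.tan (Complex.arg u) := Real.tan_neg _
        _ ≤ _ := neg_le_abs _
  rw [Complex.tan_arg, abs_div, abs_of_pos hu] at key
  exact key

/-- Polar decomposition of `e^{-S}`: `e^{-S} = e^{-Re S} · e^{-i Im S}`. [folklore] -/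
theorem exp_neg_eq (S : ℂ) :
    Complex.exp (-S) =
      (Real.exp (-S.re) : ℂ) * Complex.exp (Complex.I * ((-S.im : ℝ) : ℂ)) := by
  rw [Complex.ofReal_exp, ← Complex.exp_add]
  congr 1
  apply Complex.ext <;> simp

/-- **The first-order perturbation estimate** (complex step of [PetersRegts2019, Lemma 4.1]
in the coordinate `s = log (1 + R)`): if `‖z - t‖ ≤ r' t` and `|Im S| ≤ b`, then
`u = 1 + z e^{-S}` is within `m (r' + b)` of the real model value `1 + m`, `m = t e^{-Re S}`
(from `‖e^{iθ} - 1‖ ≤ |θ|`). [cite: PetersRegts2019, Lemma 4.1] -/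
theorem norm_one_add_mul_exp_neg_sub_le {t r' b : ℝ} (ht : 0 < t) {z : ℂ}
    (hz : ‖z - t‖ ≤ r' * t) (S : ℂ) (hb : |S.im| ≤ b) :
    ‖(1 + z * Complex.exp (-S)) - ((1 + t * Real.exp (-S.re) : ℝ) : ℂ)‖ ≤
      t * Real.exp (-S.re) * (r' + b) := by
  set A := S.re
  set B := S.im
  have hE := exp_neg_eq S
  have h1 : ‖Complex.exp (-S)‖ = Real.exp (-A) := by
    rw [Complex.norm_exp]; simp [A]
  have h2 : ‖Complex.exp (-S) - (Real.exp (-A) : ℂ)‖ ≤ Real.exp (-A) * |B| := by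
    rw [hE, ← mul_sub_one, norm_mul, Complex.norm_real, Real.norm_of_nonneg (Real.exp_pos _).le]
    refine mul_le_mul_of_nonneg_left ?_ (Real.exp_pos _).le
    calc ‖Complex.exp (Complex.I * ((-B : ℝ) : ℂ)) - 1‖ ≤ ‖(-B : ℝ)‖ :=
          Real.norm_exp_I_mul_ofReal_sub_one_le
      _ = |B| := by rw [Real.norm_eq_abs, abs_neg]
  have hsplit : (1 + z * Complex.exp (-S)) - ((1 + t * Real.exp (-A) : ℝ) : ℂ) =
      (z - t) * Complex.exp (-S) + t * (Complex.exp (-S) - (Real.exp (-A) : ℂ)) := by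
    push_cast; ring
  rw [hsplit]
  calc ‖(z - t) * Complex.exp (-S) + t * (Complex.exp (-S) - (Real.exp (-A) : ℂ))‖
      ≤ ‖(z - t) * Complex.exp (-S)‖ + ‖(t : ℂ) * (Complex.exp (-S) - (Real.exp (-A) : ℂ))‖ :=
        norm_add_le _ _
    _ = ‖z - t‖ * Real.exp (-A) + t * ‖Complex.exp (-S) - (Real.exp (-A) : ℂ)‖ := by
        rw [norm_mul, norm_mul, h1, Complex.norm_real, Real.norm_of_nonneg ht.le]
    _ ≤ r' * t * Real.exp (-A) + t * (Real.exp (-A) * |B|) := by gcongr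
    _ ≤ r' * t * Real.exp (-A) + t * (Real.exp (-A) * b) := by gcongr
    _ = t * Real.exp (-A) * (r' + b) := by ring

/-- A complex number within `ρ` of the real number `1 + m` has real part at least
`1 + m - ρ`, imaginary part at most `ρ` in absolute value, and norm at most `|1 + m| + ρ`.
[folklore] -/
theorem re_im_norm_of_norm_sub_le {u : ℂ} {m ρ : ℝ} (h : ‖u - (1 + m : ℝ)‖ ≤ ρ) :
    1 + m - ρ ≤ u.re ∧ |u.im| ≤ ρ ∧ ‖u‖ ≤ |1 + m| + ρ := by
  refine ⟨?_, ?_, ?_⟩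
  · have := (Complex.abs_re_le_norm (u - (1 + m : ℝ))).trans h
    rw [Complex.sub_re, Complex.ofReal_re] at this
    linarith [(abs_le.1 this).1]
  · have := (Complex.abs_im_le_norm (u - (1 + m : ℝ))).trans h
    rwa [Complex.sub_im, Complex.ofReal_im, sub_zero] at this
  · calc ‖u‖ = ‖((1 + m : ℝ) : ℂ) + (u - (1 + m : ℝ))‖ := by rw [add_sub_cancel]
      _ ≤ ‖((1 + m : ℝ) : ℂ)‖ + ‖u - (1 + m : ℝ)‖ := norm_add_le _ _
      _ ≤ |1 + m| + ρ := by rw [Complex.norm_real, Real.norm_eq_abs]; gcongr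

/-- **Estimates for `log u` in the right half-plane**: if `0 < lo ≤ Re u`, `|Im u| ≤ η` and
`‖u‖ ≤ hi`, then `u ≠ 0`, `log lo ≤ Re (log u) ≤ log hi`, `|Im (log u)| ≤ η / lo` and
`√(1 - lo⁻¹) ≤ √(1 - e^{-Re (log u)})`. [folklore] -/
theorem log_estimates {u : ℂ} {lo hi η : ℝ} (hlo : 0 < lo) (hre : lo ≤ u.re) (him : |u.im| ≤ η)
    (hη : 0 ≤ η) (hnorm : ‖u‖ ≤ hi) :
    u ≠ 0 ∧ Real.log lo ≤ (Complex.log u).re ∧ (Complex.log u).re ≤ Real.log hi ∧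
      |(Complex.log u).im| ≤ η / lo ∧
      √(1 - lo⁻¹) ≤ √(1 - Real.exp (-(Complex.log u).re)) := by
  have hure : 0 < u.re := hlo.trans_le hre
  have hu0 : u ≠ 0 := fun h => by rw [h, Complex.zero_re] at hure; exact lt_irrefl _ hure
  have hun : 0 < ‖u‖ := norm_pos_iff.2 hu0
  have hlon : lo ≤ ‖u‖ := hre.trans (Complex.re_le_norm u)
  refine ⟨hu0, ?_, ?_, ?_, ?_⟩
  · rw [Complex.log_re]; exact Real.log_le_log hlo hlon
  · rw [Complex.log_re]; exact Real.log_le_log hun hnorm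
  · rw [Complex.log_im]
    calc |Complex.arg u| ≤ |u.im| / u.re := abs_arg_le_abs_im_div_re hure
      _ ≤ η / lo := by gcongr
  · rw [Complex.log_re, Real.exp_neg, Real.exp_log hun]
    gcongr

/-- **The bookkeeping of the constants.** With gap `g = 1 - κ² ∈ (0, 1]`, width
`ε ∈ (0, 1]`, `ε β ≤ g/8`, radius `0 ≤ r' ≤ ε g/10`, `0 < m ≤ t ≤ 4` and the contraction
bound `β² m ≤ (1 - g)(1 + m)`, the perturbation `δ = r' + ε β` satisfies
`m δ² ≤ ε² (1 - δ)(1 + m (1 - δ))`, which is what closes the invariant region.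
[folklore] -/
theorem numeric_core {g ε r' t m β : ℝ} (hg0 : 0 < g) (hg1 : g ≤ 1) (hε : 0 < ε)
    (hε1 : ε ≤ 1) (hβ : 0 ≤ β) (hεβ : ε * β ≤ g / 8) (hr0 : 0 ≤ r') (hr : r' ≤ ε * g / 10)
    (ht : t ≤ 4) (hm0 : 0 < m) (hmt : m ≤ t) (hF1 : β ^ 2 * m ≤ (1 - g) * (1 + m)) :
    m * (r' + ε * β) ^ 2 ≤ ε ^ 2 * (1 - (r' + ε * β)) * (1 + m * (1 - (r' + ε * β))) := by
  -- `m β ≤ 1 + m`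
  have hmβ : m * β ≤ 1 + m := by
    rcases le_or_gt β 1 with hβ1 | hβ1
    · nlinarith
    · calc m * β ≤ m * β * β := le_mul_of_one_le_right (by positivity) hβ1.le
        _ = β ^ 2 * m := by ring
        _ ≤ (1 - g) * (1 + m) := hF1
        _ ≤ 1 + m := by nlinarith
  have hδ : r' + ε * β ≤ 9 * g / 40 := by nlinarith
  -- the three pieces of `m (r' + ε β)²`
  have f1 : m * r' ^ 2 ≤ ε ^ 2 * (g / 25) := by
    calc m * r' ^ 2 ≤ 4 * (ε * g / 10) ^ 2 := by
          have : r' ^ 2 ≤ (ε * g / 10) ^ 2 := pow_le_pow_left₀ hr0 hr 2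
          nlinarith
      _ = ε ^ 2 * (g / 25) * g := by ring
      _ ≤ ε ^ 2 * (g / 25) * 1 := by gcongr
      _ = _ := mul_one _
  have f2 : m * (2 * r' * (ε * β)) ≤ ε ^ 2 * (g / 5) * (1 + m) := by
    calc m * (2 * r' * (ε * β)) = 2 * r' * (ε * (m * β)) := by ring
      _ ≤ 2 * (ε * g / 10) * (ε * (1 + m)) := by gcongr
      _ = _ := by ring
  have f3 : m * (ε * β) ^ 2 ≤ ε ^ 2 * (1 - g) * (1 + m) := by nlinarith
  have lhs : m * (r' + ε * β) ^ 2 ≤ ε ^ 2 * ((1 + m) * (1 - 19 * g / 25)) := by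
    have e : m * (r' + ε * β) ^ 2 = m * r' ^ 2 + m * (2 * r' * (ε * β)) + m * (ε * β) ^ 2 := by
      ring
    have p : 0 ≤ ε ^ 2 * g * m := by positivity
    nlinarith [f1, f2, f3, e, p]
  have rhs : (1 + m) * (1 - 19 * g / 25) ≤
      (1 - (r' + ε * β)) * (1 + m * (1 - (r' + ε * β))) := by
    have hδ0 : 0 ≤ r' + ε * β := by positivity
    nlinarith [mul_nonneg hm0.le (sq_nonneg (r' + ε * β)), mul_nonneg hm0.le hδ0]
  calc m * (r' + ε * β) ^ 2 ≤ ε ^ 2 * ((1 + m) * (1 - 19 * g / 25)) := lhs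
    _ ≤ ε ^ 2 * ((1 - (r' + ε * β)) * (1 + m * (1 - (r' + ε * β)))) :=
        mul_le_mul_of_nonneg_left rhs (sq_nonneg ε)
    _ = _ := by ring

/-- **The forward-invariant region** (the analogue of [PetersRegts2019, Lemma 4.1], in the
coordinate `s = log (1 + R)` and with explicit constants).  Fix `d ≥ 2`, a centre
`0 < t < Λ = λ_c(d+1)`, and put `κ² = t(Λ+1)/(Λ(1+t))`, `g = 1 - κ²`, `ε = g/(8d)`,
`r' = ε g/10`, `σ₁ = log (1 + 2t)`, `σ₀ = log (1 + t e^{-d σ₁}/2)` and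
`T = {s : σ₀ ≤ Re s ≤ σ₁, |Im s| ≤ ε √(1 - e^{-Re s})}`.  Then for every activity `z` with
`‖z - t‖ ≤ r' t` and every family `(sᵢ)_{i ∈ M}` in `T`: (b) if `#M ≤ d + 1` then
`1 + z e^{-∑ sᵢ} ≠ 0`; (a) if `#M ≤ d` then moreover `log (1 + z e^{-∑ sᵢ}) ∈ T`.
Proof: `Re ∑ sᵢ =: A ∈ [kσ₀, kσ₁]`, `|Im ∑ sᵢ| ≤ ε ∑ √(1 - e^{-Re sᵢ}) =: ε β`; the value
`u = 1 + z e^{-∑ sᵢ}` is within `m (r' + ε β)` of `1 + m`, `m = t e^{-A}`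
(`norm_one_add_mul_exp_neg_sub_le`); then `log_estimates`, and the width closes up by
`contraction_bound` and `numeric_core`. [cite: PetersRegts2019, Lemma 4.1] -/
theorem region_step {d : ℕ} (hd : 2 ≤ d) {t Λ g ε r' σ₀ σ₁ : ℝ}
    (hΛ : Λ = hardCoreThreshold (d + 1)) (ht0 : 0 < t) (htΛ : t < Λ)
    (hg : g = 1 - t * (Λ + 1) / (Λ * (1 + t))) (hε : ε = g / (8 * d)) (hr' : r' = ε * g / 10)
    (hσ₁ : σ₁ = Real.log (1 + 2 * t)) (hσ₀ : σ₀ = Real.log (1 + t * Real.exp (-(d * σ₁)) / 2))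
    {z : ℂ} (hz : ‖z - t‖ ≤ r' * t) {ι : Type*} {M : Finset ι} {s : ι → ℂ}
    (hs : ∀ i ∈ M, σ₀ ≤ (s i).re ∧ (s i).re ≤ σ₁ ∧
      |(s i).im| ≤ ε * √(1 - Real.exp (-(s i).re))) :
    (M.card ≤ d + 1 → 1 + z * Complex.exp (-∑ i ∈ M, s i) ≠ 0) ∧
    (M.card ≤ d →
      σ₀ ≤ (Complex.log (1 + z * Complex.exp (-∑ i ∈ M, s i))).re ∧
      (Complex.log (1 + z * Complex.exp (-∑ i ∈ M, s i))).re ≤ σ₁ ∧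
      |(Complex.log (1 + z * Complex.exp (-∑ i ∈ M, s i))).im| ≤
        ε * √(1 - Real.exp (-(Complex.log (1 + z * Complex.exp (-∑ i ∈ M, s i))).re))) := by
  -- constants
  have hd' : (2 : ℝ) ≤ d := by exact_mod_cast hd
  have hΛpos : 0 < Λ := hΛ ▸ hardCoreThreshold_pos (by omega)
  have hΛ4 : Λ ≤ 4 := hΛ ▸ hardCoreThreshold_le_four (by omega)
  have ht4 : t ≤ 4 := htΛ.le.trans hΛ4
  have hκ0 : 0 < t * (Λ + 1) / (Λ * (1 + t)) := by positivity
  have hκ1 : t * (Λ + 1) / (Λ * (1 + t)) < 1 := by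
    rw [div_lt_one (by positivity)]; linarith
  have hg0 : 0 < g := by rw [hg]; linarith
  have hg1 : g ≤ 1 := by rw [hg]; linarith
  have hε0 : 0 < ε := by rw [hε]; positivity
  have hεd : ε * d = g / 8 := by rw [hε]; field_simp
  have hε16 : ε ≤ 1 / 16 := by
    have := mul_le_mul_of_nonneg_left hd' hε0.le
    linarith
  have hε1 : ε ≤ 1 := by linarith
  have hεg : ε * g ≤ 1 := mul_le_one₀ hε1 hg0.le hg1
  have hr0 : 0 ≤ r' := by rw [hr']; positivity
  have hr1 : r' ≤ ε * g / 10 := by rw [hr']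
  have hr2 : r' ≤ 1 / 10 := by linarith
  have hσ₁0 : 0 ≤ σ₁ := by rw [hσ₁]; exact Real.log_nonneg (by linarith)
  have hσ₀0 : 0 < σ₀ := by rw [hσ₀]; exact Real.log_pos (by simp; positivity)
  -- the aggregate `S = A + iB`
  set S : ℂ := ∑ i ∈ M, s i with hS
  set k : ℕ := M.card with hk
  have hAsum : S.re = ∑ i ∈ M, (s i).re := by rw [hS, Complex.re_sum]
  have hre0 : ∀ i ∈ M, 0 ≤ (s i).re := fun i hi => hσ₀0.le.trans (hs i hi).1
  have hA0 : 0 ≤ S.re := by rw [hAsum]; exact sum_nonneg hre0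
  have hA1 : S.re ≤ k * σ₁ := by
    rw [hAsum]
    calc ∑ i ∈ M, (s i).re ≤ ∑ i ∈ M, σ₁ := sum_le_sum fun i hi => (hs i hi).2.1
      _ = k * σ₁ := by rw [sum_const, nsmul_eq_mul]
  set β : ℝ := ∑ i ∈ M, √(1 - Real.exp (-(s i).re)) with hβ
  have hβ0 : 0 ≤ β := sum_nonneg fun i _ => Real.sqrt_nonneg _
  have hβk : β ≤ k := by
    calc β ≤ ∑ i ∈ M, (1 : ℝ) := sum_le_sum fun i _ => Real.sqrt_le_one.2
          (by linarith [Real.exp_pos (-(s i).re)])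
      _ = k := by rw [sum_const, nsmul_eq_mul, mul_one]
  have hBβ : |S.im| ≤ ε * β := by
    rw [hS, Complex.im_sum, hβ, mul_sum]
    exact (abs_sum_le_sum_abs _ _).trans (sum_le_sum fun i hi => (hs i hi).2.2)
  -- the real model value `m = t e^{-A}`
  set m : ℝ := t * Real.exp (-S.re) with hm
  have hm0 : 0 < m := by positivity
  have hmt : m ≤ t := by
    rw [hm]
    calc t * Real.exp (-S.re) ≤ t * 1 := by
          gcongr; exact Real.exp_le_one_iff.2 (by linarith)
      _ = t := mul_one t
  -- the perturbation estimate
  have hpert := norm_one_add_mul_exp_neg_sub_le ht0 hz S hBβ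
  rw [← hm] at hpert
  obtain ⟨hure, huim, hun⟩ := re_im_norm_of_norm_sub_le hpert
  rw [abs_of_pos (by positivity : (0 : ℝ) < 1 + m)] at hun
  refine ⟨fun hkd => ?_, fun hkd => ?_⟩
  · -- part (b): `k ≤ d + 1`, the real part of `u` is positive
    have hkr : (k : ℝ) ≤ d + 1 := by exact_mod_cast hkd
    have hδ : r' + ε * β < 1 := by
      have : ε * β ≤ ε * (d + 1) := mul_le_mul_of_nonneg_left (hβk.trans hkr) hε0.le
      linarith
    have hpos : 0 < (1 + z * Complex.exp (-S)).re := by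
      have := mul_pos hm0 (sub_pos.2 hδ)
      linarith
    intro h0
    rw [h0, Complex.zero_re] at hpos
    exact lt_irrefl _ hpos
  · -- part (a): `k ≤ d`
    have hkr : (k : ℝ) ≤ d := by exact_mod_cast hkd
    have hεβ : ε * β ≤ g / 8 := by
      calc ε * β ≤ ε * d := mul_le_mul_of_nonneg_left (hβk.trans hkr) hε0.le
        _ = g / 8 := hεd
    -- the contraction bound `β² m ≤ (1 - g) (1 + m)`
    have hF1 : β ^ 2 * m ≤ (1 - g) * (1 + m) := by
      have h := contraction_bound hΛ hΛpos ht0 htΛ hkd (fun i => (s i).re) hre0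
      rw [← hAsum, ← hβ, ← hm] at h
      calc β ^ 2 * m ≤ t * (Λ + 1) / (Λ * (1 + t)) * (1 + m) := h
        _ = (1 - g) * (1 + m) := by rw [hg]; ring
    have hnum := numeric_core hg0 hg1 hε0 hε1 hβ0 hεβ hr0 hr1 ht4 hm0 hmt hF1
    set δ : ℝ := r' + ε * β with hδ
    have hδ0 : 0 ≤ δ := by positivity
    have hδ1 : δ ≤ 1 / 4 := by rw [hδ]; linarith
    set c : ℝ := 1 - δ with hc
    have hc0 : 3 / 4 ≤ c := by linarith
    have hc1 : c ≤ 1 := by linarith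
    have hlo : 0 < 1 + m * c := by positivity
    have hure' : 1 + m * c ≤ (1 + z * Complex.exp (-S)).re := by rw [hc]; linarith
    obtain ⟨hu0, hlo1, hhi1, him1, hsq⟩ :=
      log_estimates hlo hure' huim (by positivity) hun
    refine ⟨?_, ?_, ?_⟩
    · -- lower bound `σ₀`
      refine le_trans ?_ hlo1
      rw [hσ₀]
      refine Real.log_le_log (by positivity) ?_
      have hAd : S.re ≤ d * σ₁ := hA1.trans (mul_le_mul_of_nonneg_right hkr hσ₁0)
      have hmlo : t * Real.exp (-(d * σ₁)) ≤ m := by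
        rw [hm]; gcongr
      have := mul_le_mul hmlo hc0 (by norm_num) hm0.le
      have : 0 ≤ t * Real.exp (-(d * σ₁)) := by positivity
      linarith
    · -- upper bound `σ₁`
      refine hhi1.trans ?_
      rw [hσ₁]
      refine Real.log_le_log (by positivity) ?_
      have : m * δ ≤ m := mul_le_of_le_one_right hm0.le (by linarith)
      linarith
    · -- the width
      refine him1.trans (le_trans ?_ (mul_le_mul_of_nonneg_left hsq hε0.le))
      have hinner : 1 - (1 + m * c)⁻¹ = m * c / (1 + m * c) := by field_simp; ring
      rw [hinner]
      have hl0 : 0 ≤ m * δ / (1 + m * c) := by positivity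
      rw [← Real.sqrt_sq hε0.le, ← Real.sqrt_mul (sq_nonneg ε), ← Real.sqrt_sq hl0]
      refine Real.sqrt_le_sqrt ?_
      rw [div_pow, div_le_iff₀ (by positivity)]
      calc (m * δ) ^ 2 = m * (m * δ ^ 2) := by ring
        _ ≤ m * (ε ^ 2 * c * (1 + m * c)) := mul_le_mul_of_nonneg_left hnum hm0.le
        _ = ε ^ 2 * (m * c / (1 + m * c)) * (1 + m * c) ^ 2 := by field_simp

/-- `κ² < 1` below the threshold: `0 < 1 - t(Λ+1)/(Λ(1+t))` for `0 ≤ t < Λ`. [folklore] -/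
theorem gap_pos {Λ t : ℝ} (hΛ : 0 < Λ) (ht : 0 ≤ t) (htΛ : t < Λ) :
    0 < 1 - t * (Λ + 1) / (Λ * (1 + t)) := by
  rw [sub_pos, div_lt_one (by positivity)]
  nlinarith

end PetersRegts

section PetersRegtsInduction

variable {V : Type*} [Fintype V] [DecidableEq V] {G : SimpleGraph V} [DecidableRel G.Adj]

/-- **The Peters–Regts induction over vertex subsets** [PetersRegts2019, Lemma 2.2 and the
proof of Thm. 4.2], for the hard-core gas on a graph of maximum degree at most `d + 1`, run on
the restrictions `Z_K` of the partition function to vertex subsets `K` in the coordinate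
`s = log (1 + R)`: suppose a region `T ⊆ ℂ` satisfies, for the activity `z`,
(a) `1 + z e^{-∑_{i ∈ M} sᵢ} ≠ 0` and `log (1 + z e^{-∑ sᵢ}) ∈ T` whenever `#M ≤ d` and all
`sᵢ ∈ T`, and (b) `1 + z e^{-∑_{i ∈ M} sᵢ} ≠ 0` whenever `#M ≤ d + 1` and all `sᵢ ∈ T`.
Then every `Z_K ≠ 0`.  The induction carries along `Z_K = e^{s} Z_{K - u}` with `s ∈ T` for
every `u ∈ K` with at most `d` neighbours in `K`: the neighbours `u₁, …, u_k` of `u` in `K - u`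
are removed one at a time (each has lost the neighbour `u`, so has at most `d` neighbours
left), telescoping to `Z_{K-u} = e^{∑ sᵢ} Z_{K - N[u]}` (Weitz; ibid. Lemma 2.2), and then
`Z_K = Z_{K-u} + z Z_{K-N[u]} = (1 + z e^{-∑ sᵢ}) Z_{K-u}`.
[cite: PetersRegts2019, Thm. 4.2 (proof)] -/
theorem polymerPartitionFunction_adj_ne_zero_of_region {d : ℕ} (hG : G.maxDegree ≤ d + 1)
    (T : Set ℂ) {z : ℂ}
    (ha : ∀ (M : Finset V) (s : V → ℂ), M.card ≤ d → (∀ i ∈ M, s i ∈ T) →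
      1 + z * Complex.exp (-∑ i ∈ M, s i) ≠ 0 ∧
        Complex.log (1 + z * Complex.exp (-∑ i ∈ M, s i)) ∈ T)
    (hb : ∀ (M : Finset V) (s : V → ℂ), M.card ≤ d + 1 → (∀ i ∈ M, s i ∈ T) →
      1 + z * Complex.exp (-∑ i ∈ M, s i) ≠ 0)
    (K : Finset V) : polymerPartitionFunction G.Adj (fun _ => z) K ≠ 0 := by
  set Z : Finset V → ℂ := fun K => polymerPartitionFunction G.Adj (fun _ => z) K with hZ
  have hsymm : ∀ u v : V, G.Adj u v → G.Adj v u := fun _ _ h => h.symm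
  -- degree bookkeeping: the neighbours of `u` inside any `B` number at most `d + 1`, and at
  -- most `d` if some neighbour `w` of `u` lies outside `B`
  have hdeg : ∀ (u : V) (B : Finset V), (B.filter (G.Adj u)).card ≤ d + 1 := fun u B =>
    calc (B.filter (G.Adj u)).card ≤ (G.neighborFinset u).card :=
          card_le_card fun m hm => (G.mem_neighborFinset u m).2 (mem_filter.1 hm).2
      _ ≤ d + 1 := (G.degree_le_maxDegree u).trans hG
  have hdeg' : ∀ (u w : V) (B : Finset V), G.Adj u w → w ∉ B →
      (B.filter (G.Adj u)).card ≤ d := by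
    intro u w B huw hwB
    have hsub : B.filter (G.Adj u) ⊆ (G.neighborFinset u).erase w := fun m hm =>
      mem_erase.2 ⟨fun h => hwB (h ▸ (mem_filter.1 hm).1),
        (G.mem_neighborFinset u m).2 (mem_filter.1 hm).2⟩
    calc (B.filter (G.Adj u)).card ≤ ((G.neighborFinset u).erase w).card := card_le_card hsub
      _ = G.degree u - 1 := by
          rw [card_erase_of_mem ((G.mem_neighborFinset u w).2 huw),
            G.card_neighborFinset_eq_degree]
      _ ≤ d := by have := (G.degree_le_maxDegree u).trans hG; omega
  -- the joint induction
  suffices main : ∀ K : Finset V, Z K ≠ 0 ∧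
      ∀ u ∈ K, ((K.erase u).filter (G.Adj u)).card ≤ d →
        ∃ s ∈ T, Z K = Complex.exp s * Z (K.erase u) from
    (main K).1
  intro K
  induction K using Finset.strongInduction with
  | H K ih =>
    -- telescoping: remove, one at a time, a set `M ⊆ B` of neighbours of a vertex `w ∉ B`
    have tele : ∀ (w : V) (B : Finset V), B ⊂ K → w ∉ B → ∀ M : Finset V, M ⊆ B →
        (∀ m ∈ M, G.Adj w m) →
          ∃ s : V → ℂ, (∀ m ∈ M, s m ∈ T) ∧
            Z B = Complex.exp (∑ m ∈ M, s m) * Z (B \ M) := by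
      intro w B hB hwB M
      induction M using Finset.induction_on with
      | empty => intro _ _; exact ⟨fun _ => 0, by simp, by simp⟩
      | @insert m M hm ihM =>
        intro hMB hM
        obtain ⟨s, hsT, hsZ⟩ := ihM ((subset_insert m M).trans hMB)
          fun m' hm' => hM m' (mem_insert_of_mem hm')
        have hmBM : m ∈ B \ M := mem_sdiff.2 ⟨hMB (mem_insert_self m M), hm⟩
        have hBM : B \ M ⊂ K := lt_of_le_of_lt sdiff_le hB
        have hwBM : w ∉ B \ M := fun h => hwB (mem_sdiff.1 h).1
        have hd : (((B \ M).erase m).filter (G.Adj m)).card ≤ d :=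
          hdeg' m w _ (hsymm _ _ (hM m (mem_insert_self m M)))
            (fun h => hwBM (mem_erase.1 h).2)
        obtain ⟨s', hs'T, hs'Z⟩ := (ih _ hBM).2 m hmBM hd
        have hne : ∀ m' ∈ M, m' ≠ m := fun m' hm'M h => hm (h ▸ hm'M)
        refine ⟨Function.update s m s', ?_, ?_⟩
        · intro m' hm'
          rcases mem_insert.1 hm' with rfl | hm'M
          · rw [Function.update_self]; exact hs'T
          · rw [Function.update_of_ne (hne m' hm'M)]; exact hsT m' hm'M
        · rw [sum_insert hm, Function.update_self, sdiff_insert,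
            sum_congr rfl fun m' hm'M => Function.update_of_ne (hne m' hm'M) _ _,
            Complex.exp_add, hsZ, hs'Z]
          ring
    -- the one-vertex step at `u ∈ K`: with `B = K - u`, `M` = the neighbours of `u` in `B`,
    -- `Z K = Z B + z · Z (B \ M)` and `Z B = exp (∑ s) · Z (B \ M)`
    have step : ∀ u ∈ K, Z (K.erase u) ≠ 0 ∧ ∃ s : V → ℂ,
        (∀ m ∈ (K.erase u).filter (G.Adj u), s m ∈ T) ∧
        Z K = (1 + z * Complex.exp (-∑ m ∈ (K.erase u).filter (G.Adj u), s m)) *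
          Z (K.erase u) := by
      intro u hu
      set B := K.erase u with hB
      set M := B.filter (G.Adj u) with hM
      have hBK : B ⊂ K := erase_ssubset hu
      have huB : u ∉ B := notMem_erase u K
      refine ⟨(ih B hBK).1, ?_⟩
      obtain ⟨s, hsT, hsZ⟩ :=
        tele u B hBK huB M (filter_subset _ _) fun m hm => (mem_filter.1 hm).2
      refine ⟨s, hsT, ?_⟩
      have hrec : Z K = Z B + z * Z (B \ M) := by
        have h := polymerPartitionFunction_eq_erase_add (inc := G.Adj) hsymm (fun _ => z) hu
        rw [hM, ← filter_not]
        exact h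
      rw [hrec, hsZ]
      rw [show (1 + z * Complex.exp (-∑ m ∈ M, s m)) *
            (Complex.exp (∑ m ∈ M, s m) * Z (B \ M)) =
          (Complex.exp (∑ m ∈ M, s m) +
            z * (Complex.exp (-∑ m ∈ M, s m) * Complex.exp (∑ m ∈ M, s m))) * Z (B \ M) by
          ring,
        ← Complex.exp_add, neg_add_cancel, Complex.exp_zero, mul_one]
      ring
    refine ⟨?_, ?_⟩
    · -- `Z K ≠ 0`
      rcases K.eq_empty_or_nonempty with rfl | ⟨u, hu⟩
      · simp [hZ]
      · obtain ⟨hB0, s, hsT, hK⟩ := step u hu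
        rw [hK]
        exact mul_ne_zero (hb _ s (hdeg u _) hsT) hB0
    · -- the ratio at a vertex with at most `d` neighbours in `K`
      intro u hu hd
      obtain ⟨-, s, hsT, hK⟩ := step u hu
      obtain ⟨hne, hlog⟩ := ha _ s hd hsT
      exact ⟨_, hlog, by rw [Complex.exp_log hne]; exact hK⟩

end PetersRegtsInduction

/-- **The Peters–Regts theorem (Sokal's conjecture), proved** [PetersRegts2019, Thm. 1.1]:
for every `Δ ≥ 3` there is a complex domain `D_Δ ⊇ [0, λ_c(Δ))` on which `Z_G(z) ≠ 0` for
every finite graph `G` of maximum degree at most `Δ`.  The domain is the union of the balls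
`B(t, rad t)`, `t ∈ [0, λ_c(Δ))`, where `rad t` is half of Shearer's radius for `t` up to half
of Shearer's radius (those balls lie in Shearer's disc,
`independencePolynomial_ne_zero_of_norm_lt`) and `rad t = r'(t) · t` beyond, with the
forward-invariant region of `PetersRegts.region_step` fed into the induction
`polymerPartitionFunction_adj_ne_zero_of_region` (ibid. Thm. 4.2 and the proof of Thm. 1.1:
union over the centres; connectedness because every ball meets the segment).
[cite: PetersRegts2019, Thm. 1.1] -/
theorem PetersRegts2019_zeroFree_holds : PetersRegts2019_zeroFree := by
  intro Δ hΔ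
  obtain ⟨d, rfl⟩ : ∃ d, Δ = d + 1 := ⟨Δ - 1, by omega⟩
  have hd : 2 ≤ d := by omega
  have hdr : (0 : ℝ) < d := by exact_mod_cast (show 0 < d by omega)
  -- Shearer's radius and the tree threshold
  set ρ : ℝ := (((d + 1 : ℕ) : ℝ) - 1) ^ (d + 1 - 1) / ((d + 1 : ℕ) : ℝ) ^ (d + 1) with hρ
  have hρ0 : 0 < ρ := by
    rw [hρ]
    exact div_pos (pow_pos (by push_cast; linarith) _) (pow_pos (by positivity) _)
  set Λ : ℝ := hardCoreThreshold (d + 1) with hΛ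
  have hΛ0 : 0 < Λ := hardCoreThreshold_pos (by omega)
  -- the parameters of the invariant region around a centre `t ∈ (0, Λ)`
  set g : ℝ → ℝ := fun t => 1 - t * (Λ + 1) / (Λ * (1 + t)) with hg
  set ε : ℝ → ℝ := fun t => g t / (8 * d) with hε
  set r' : ℝ → ℝ := fun t => ε t * g t / 10 with hr'
  set σ₁ : ℝ → ℝ := fun t => Real.log (1 + 2 * t) with hσ₁
  set σ₀ : ℝ → ℝ := fun t => Real.log (1 + t * Real.exp (-(d * σ₁ t)) / 2) with hσ₀
  set rad : ℝ → ℝ := fun t => if t ≤ ρ / 2 then ρ / 2 else r' t * t with hrad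
  have hrad0 : ∀ t, 0 ≤ t → t < Λ → 0 < rad t := by
    intro t ht htΛ
    simp only [hrad]
    split_ifs with h
    · positivity
    · have hg0 : 0 < g t := PetersRegts.gap_pos hΛ0 ht htΛ
      have ht0 : 0 < t := by linarith
      simp only [hr', hε]
      positivity
  set D : Set ℂ := ⋃ t ∈ Set.Ico (0 : ℝ) Λ, Metric.ball (t : ℂ) (rad t) with hD
  have hmemD : ∀ t : ℝ, 0 ≤ t → t < Λ → (t : ℂ) ∈ D := fun t ht htΛ =>
    Set.mem_iUnion₂.2 ⟨t, ⟨ht, htΛ⟩, Metric.mem_ball_self (hrad0 t ht htΛ)⟩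
  refine ⟨D, isOpen_biUnion fun _ _ => Metric.isOpen_ball, ⟨⟨0, ?_⟩, ?_⟩, hmemD, ?_⟩
  · exact_mod_cast hmemD 0 le_rfl hΛ0
  · -- connectedness: every point is joined to `0` by a ball plus a piece of the segment
    refine isPreconnected_of_forall (0 : ℂ) fun y hy => ?_
    obtain ⟨t, ⟨ht, htΛ⟩, hyt⟩ := Set.mem_iUnion₂.1 hy
    refine ⟨Metric.ball (t : ℂ) (rad t) ∪ ((↑) : ℝ → ℂ) '' Set.Icc 0 t, ?_, ?_, Or.inl hyt, ?_⟩
    · refine Set.union_subset (fun w hw => Set.mem_iUnion₂.2 ⟨t, ⟨ht, htΛ⟩, hw⟩) ?_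
      rintro _ ⟨t', ⟨ht'0, ht't⟩, rfl⟩
      exact hmemD t' ht'0 (ht't.trans_lt htΛ)
    · exact Or.inr ⟨0, ⟨le_rfl, ht⟩, Complex.ofReal_zero⟩
    · exact IsPreconnected.union (t : ℂ) (Metric.mem_ball_self (hrad0 t ht htΛ))
        ⟨t, ⟨ht, le_rfl⟩, rfl⟩ (convex_ball _ _).isPreconnected
        (isPreconnected_Icc.image _ Complex.continuous_ofReal.continuousOn)
  · -- zero-freeness
    intro W _ _ H _ hH z hz
    obtain ⟨t, ⟨ht, htΛ⟩, hzt⟩ := Set.mem_iUnion₂.1 hz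
    rw [Metric.mem_ball, dist_eq_norm] at hzt
    simp only [hrad] at hzt
    split_ifs at hzt with hle
    · -- inside Shearer's disc
      refine independencePolynomial_ne_zero_of_norm_lt (Δ := d + 1) (by omega) hH ?_
      rw [← hρ]
      calc ‖z‖ = ‖(z - t) + t‖ := by rw [sub_add_cancel]
        _ ≤ ‖z - t‖ + ‖(t : ℂ)‖ := norm_add_le _ _
        _ < ρ / 2 + ρ / 2 := by
            rw [Complex.norm_real, Real.norm_of_nonneg ht]; linarith
        _ = ρ := by ring
    · -- the Peters–Regts region around the centre `t ∈ (ρ/2, Λ)`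
      have ht0 : 0 < t := by linarith
      rw [independencePolynomial_eq_polymerPartitionFunction]
      set T : Set ℂ := {s | σ₀ t ≤ s.re ∧ s.re ≤ σ₁ t ∧
        |s.im| ≤ ε t * √(1 - Real.exp (-s.re))} with hT
      have key := fun (M : Finset W) (s : W → ℂ) (hs : ∀ i ∈ M, s i ∈ T) =>
        PetersRegts.region_step hd hΛ ht0 htΛ rfl rfl rfl rfl rfl hzt.le (M := M) (s := s)
          (fun i hi => hs i hi)
      exact polymerPartitionFunction_adj_ne_zero_of_region hH T
        (fun M s hM hs => ⟨(key M s hs).1 (by omega), (key M s hs).2 hM⟩)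
        (fun M s hM hs => (key M s hs).1 hM) univ

end Literature.Probability.LatticeModels
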